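import Mathlib
import HarnessLib

/-!
# Geometric rigidity in `L^p` (Friesecke–James–Müller; `1 < p < ∞`) — named fact

Topic `Literature/Analysis/PDE` (nonlinear elasticity / calculus of variations). ONE named fact
(D-0014: `def … : Prop`, no proof), the quantitative rigidity estimate for gradient fields that are
`L^p`-close to the proper rotations:

> **Theorem 1.1** of S. Conti, G. Dolzmann, S. Müller, *Korn's second inequality and geometric
> rigidity with mixed growth conditions*, Calc. Var. PDE **50** (2014) 437–454
> [ContiDolzmannMuller2013] (p. 3 of the arXiv text 1203.1138 materialised in the tree's store):
> Let `Ω ⊂ ℝⁿ` be a bounded and connected domain with Lipschitz boundary. Suppose that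
> `1 < p < q < ∞` and that `u ∈ W^{1,1}(Ω;ℝⁿ)`, `f ∈ L^p(Ω)` and `g ∈ L^q(Ω)` are given with
> `dist(Du, SO(n)) = f + g` a.e. in `Ω`. Then there exist a constant `c`, matrix fields
> `F ∈ L^p(Ω;ℝⁿˣⁿ)`, `G ∈ L^q(Ω;ℝⁿˣⁿ)`, and a proper rotation `Q ∈ SO(n)` such that
> `Du = Q + F + G` a.e. in `Ω`, and `‖F‖_{L^p} ≤ c‖f‖_{L^p}`, `‖G‖_{L^q} ≤ c‖g‖_{L^q}`.
> The constant `c` depends only on `n`, `p`, `q`, and `Ω` but not on `u`, `f`, `g`.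
> "The case `p = 2` and `g = 0` was established in [FrieseckeJamesMuller2002, Thm. 3.1], the
> generalization to `p ∈ (1,∞)` follows from the same proof with minor changes, see
> [ContiSchweizer2006]." (loc. cit., p. 3.)

The pure-`L^p` form used here is the case `g = 0` (then `G = 0`): for every
`u ∈ W^{1,p}(Ω;ℝⁿ)` there is `Q ∈ SO(n)` with
`‖Du − Q‖_{L^p(Ω)} ≤ c(n,p,Ω) ‖dist(Du, SO(n))‖_{L^p(Ω)}`; in exactly this form, with
"the constant `C(U)` is invariant under dilation and translation of the domain", it is quoted as
Theorem 1.1 of R. Alicandro, G. Lazzaroni, M. Palombaro, *Derivation of a rod theory from lattice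
systems with interactions of finite range* (2018), p. 31, from [FrieseckeJamesMuller2002, Thm. 3.1].

## Formalisation choices (each makes the fact weaker than or equal to print)

* Space `ℝⁿ` is `EuclideanSpace ℝ (Fin n)`, `2 ≤ n`; matrices are continuous linear maps
  `EuclideanSpace ℝ (Fin n) →L[ℝ] EuclideanSpace ℝ (Fin n)` with the OPERATOR norm (print: the
  Frobenius norm; the two are equivalent on `ℝⁿˣⁿ` and the existential constant absorbs the factor).
* `SO(n)` is the set `rotations n` of norm-preserving linear maps of determinant `1`
  (= proper orthogonal matrices); `dist(A, SO(n))` is `Metric.infDist A (rotations n)`.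
* Domain: Euclidean BALLS `Metric.ball c r`, `0 < r` — bounded connected Lipschitz domains; ONE
  constant for all balls (print: `c = c(n,p,Ω)`; for balls the constant of the unit ball serves
  every `B(c,r)` by the substitution `x ↦ c + r x`, which multiplies both sides by `rⁿ` — the
  dilation/translation invariance recorded in print, Alicandro–Lazzaroni–Palombaro Thm. 1.1).
* Maps: `u` LIPSCHITZ on the ball (special case: `W^{1,∞}(B) ⊂ W^{1,p}(B)`; by Rademacher the weak
  gradient is `fderiv ℝ u` a.e., and `fderiv ℝ u` is measurable and bounded on `B`, so both Bochner
  integrals below are genuine).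
  -- TODO(general form): `u ∈ W^{1,p}(Ω;ℝⁿ)` on a bounded connected Lipschitz domain `Ω`, and the
  mixed-growth decomposition `Du = Q + F + G` of [ContiDolzmannMuller2013, Thm. 1.1].
* Exponent `p : ℝ`, `1 < p`, real powers (`Real.rpow`; the bases are non-negative).

Wanted by `Summit.AtomisticToContinuum.Crystallization` (statement 26636, line `_16XH19`): the
field-rigidity piece `FieldRigidityP` of
`Summits/AtomisticToContinuum/Crystallization/Theorems/ChartedZeroExcessLayeredLatticeLiouvilleTV.lean`
(case `n = 3`, `p = 3`, applied to a Lipschitz interpolant of the registered displacement).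

## References

* [ContiDolzmannMuller2013] S. Conti, G. Dolzmann, S. Müller, Calc. Var. PDE 50 (2014) 437–454,
  Thm. 1.1 (arXiv:1203.1138, p. 3).
* [FrieseckeJamesMuller2002] G. Friesecke, R. D. James, S. Müller, Comm. Pure Appl. Math. 55
  (2002) 1461–1506, Thm. 3.1 (`p = 2`).
* [ContiSchweizer2006] S. Conti, B. Schweizer, Comm. Pure Appl. Math. 59 (2006) 830–868, §2
  (`1 < p < ∞`).
-/

noncomputable section

open Metric MeasureTheory

namespace Literature.Analysis.PDE

/-- The proper rotations `SO(n)` inside the continuous linear endomorphisms of `ℝⁿ`: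
norm-preserving (orthogonal) and of determinant `1` (plumbing definition for the fact below). [folklore] -/
def rotations (n : ℕ) : Set (EuclideanSpace ℝ (Fin n) →L[ℝ] EuclideanSpace ℝ (Fin n)) :=
  {Q | (∀ x, ‖Q x‖ = ‖x‖) ∧
    LinearMap.det (Q : EuclideanSpace ℝ (Fin n) →ₗ[ℝ] EuclideanSpace ℝ (Fin n)) = 1}

/-- NAMED FACT — **Geometric rigidity in `L^p` (Friesecke–James–Müller 2002, Thm. 3.1 for `p = 2`;
`1 < p < ∞`: Conti–Schweizer 2006 §2, Conti–Dolzmann–Müller 2013/14 Thm. 1.1 with `g = 0`).**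
For `n ≥ 2` and `1 < p < ∞` there is a constant `C = C(n,p)` such that for every ball `B = B(c,r)`
in `ℝⁿ` and every Lipschitz map `u : B → ℝⁿ` there is a proper rotation `Q ∈ SO(n)` with
`∫_B ‖Du − Q‖^p ≤ C ∫_B dist(Du, SO(n))^p` — the printed theorem for `u ∈ W^{1,p}(Ω;ℝⁿ)` on a
bounded connected Lipschitz domain, here in the special case of Lipschitz maps on balls (one
constant for all balls by dilation/translation invariance).
[cite: ContiDolzmannMuller2013, Thm. 1.1 (case g = 0)] [cite: FrieseckeJamesMuller2002, Thm. 3.1] -/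
def FrieseckeJamesMuller2002_geometricRigidityLp : Prop :=
  ∀ (n : ℕ), 2 ≤ n → ∀ (p : ℝ), 1 < p → ∃ C : ℝ, 0 ≤ C ∧
    ∀ (c : EuclideanSpace ℝ (Fin n)) (r : ℝ), 0 < r →
    ∀ (u : EuclideanSpace ℝ (Fin n) → EuclideanSpace ℝ (Fin n)) (K : NNReal),
      LipschitzOnWith K u (ball c r) →
      ∃ Q ∈ rotations n,
        ∫ x in ball c r, ‖fderiv ℝ u x - Q‖ ^ p ≤
          C * ∫ x in ball c r, (infDist (fderiv ℝ u x) (rotations n)) ^ p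

end Literature.Analysis.PDE

end
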